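import Mathlib
import Summits.Ventures.HodgeRepro.Tier4.Common.UnitaryHyperbolic
import Summits.Ventures.HodgeRepro.Tier4.Line4.SliceModel

/-!
# Tier4/Line4/SliceModelUnitary — `U(W)(k_{w₀}) ≃ₜ* U(J)` for the row plane at a real CM place, and the size comparison
`ℓ¹ (locOf M) ≤ (1 + ‖ω‖) ℓ¹ (ι M)`

Blind re-derivation cell `pub-hodge-repro`, Tier 4 «prove the step» (README §9–§10), seat t4-L4-p2 (prover, LINE L4,
gen 5; cut C2 of C-COMMON-SL2BALL stage C, statement S15613 (M2), part c — the companion of `Line4/SliceModel`, split by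
the 400-line rule).  Tree path `lean/Summits/Ventures/HodgeRepro/Tier4/Line4/SliceModelUnitary.lean`.  Mathlib-level;
no literature.  Imports this seat's `Line4/SliceModel` (`iota`, `bw`, `realOf`, `locOf`, `blocksMat`, `IsOmegaLinear`,
`locOf_mul`, `blocksMat_mul`, `norm_bw_le`; through it `LocalBlocks` (`ScalarUnitary`,
`mem_localUnitary_ofLinesRow_iff`) and `LocalAssembly` (`localUnitary`)) and typer-2's `Common/UnitaryHyperbolic`
(`SL2Ball.Jmat`, `SL2Ball.UJ`, `SL2Ball.mem_UJ`, `SL2Ball.l1C`).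

WHAT IS PROVED.  (1) **`scalarUnitary_iff_locOf`**: for an `ω`-linear `M` the scalar unitarity equations of
`LocalBlocks` hold iff `locOf M · J · (locOf M)ᴴ = J`, `J = Jmat a_{w₀} (ε b)_{w₀}` — entry `(I, J)` of `m J mᴴ` is
`bw` of the scalar pair (`locOf_mul_J_mul_star_apply`: `bw` is additive, homogeneous and `bw (z z̄′) = bw z · conj (bw z′)`),
and `bw` is injective.  (2) `locHom : U(W)(k_{w₀}) →* U(J)` (`locOf` on the units, `locOf m⁻¹` the inverse) and
`blocksUnit : U(J) → U(W)(k_{w₀})` (`blocksMat`, its membership by (1) read backwards), mutually inverse, continuous: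
**`localModel : localUnitary (ofLinesRow q a b ε) w₀ ≃ₜ* UJ (alphaLoc a hw) (betaLoc b ε hw)`**, `alphaLoc = Φ a_{w₀}`,
`betaLoc = Φ (ε b)_{w₀}` (`Φ = ringEquivRealOfIsReal hw`).  SIGNS: `U(J)` has signature `(1,1)` when
`alphaLoc > 0 > betaLoc` — on the line's mixed plane (`ε = −1`) this is the (7a) side's `_hpos` / `IsCMAt` data at the
ONE indefinite real place `w₀` (the seesaw plane's lines both positive at `w₀`); the equivalence itself needs no sign.
(3) **`l1C_locOf_le`** — `SL2Ball.l1C (locOf M) ≤ (1 + ‖ω‖) · ∑_{ij} ‖ι (M i j)‖` (the eight block entries are among the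
sixteen), the direction stage B needs.

Consumer: `Line4/SliceBallGrowth` (stage C: `atPlace W w₀ ≃ₜ* U(J)` = `sliceEquiv.trans localModel`; Haar measures
correspond; typer-2's `haar_logSublevel_le_exp_UJ` transports to L1-p2's `SliceBallGrowth`).

Nothing here says anything about the status of the Hodge conjecture for CM abelian varieties, which is NOT proved
(HC_CM is NOT proved by anyone in this repository).
-/

set_option autoImplicit false

noncomputable section

namespace Summit.Ventures.HodgeRepro.Tier4.Line4

open Summit.Ventures.HodgeRepro.Tier4.Common NumberField Matrix Topology
open scoped ComplexConjugate

/-! ## 2′. `blocksMat`: multiplicative, unital, continuous (moved here by the 400-line rule) -/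

section ModelMore

variable {k : Type} [Field k] [NumberField k] (q : QuadData k) {w₀ : InfinitePlace k}

omit [NumberField k] in
/-- `blocksMat` is multiplicative (through `locOf`, injective on `ω`-linear matrices). -/
theorem blocksMat_mul (hw : w₀.IsReal) (hcm : IsCMAt q w₀) (m n : Matrix (Fin 2) (Fin 2) ℂ) :
    blocksMat q hw (m * n) = blocksMat q hw m * blocksMat q hw n := by
  have h : locOf q w₀ (blocksMat q hw m * blocksMat q hw n) = m * n := by
    rw [locOf_mul q hw hcm (isOmegaLinear_blocksMat q hw m) (isOmegaLinear_blocksMat q hw n), locOf_blocksMat q hw hcm,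
      locOf_blocksMat q hw hcm]
  rw [← h, blocksMat_locOf q hw hcm
    (IsOmegaLinear.mul q (isOmegaLinear_blocksMat q hw m) (isOmegaLinear_blocksMat q hw n))]

omit [NumberField k] in
/-- `blocksMat 1 = 1`. -/
theorem blocksMat_one (hw : w₀.IsReal) (hcm : IsCMAt q w₀) : blocksMat q hw (1 : Matrix (Fin 2) (Fin 2) ℂ) = 1 := by
  rw [← locOf_one q, blocksMat_locOf q hw hcm (isOmegaLinear_one q)]

omit [NumberField k] in
/-- `blocksMat` is continuous. -/
theorem continuous_blocksMat (hw : w₀.IsReal) : Continuous (blocksMat q hw) := by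
  unfold blocksMat
  have hre : Continuous fun N : Matrix (Fin 2 ⊕ Fin 2) (Fin 2 ⊕ Fin 2) w₀.Completion => re4R (R := w₀.Completion) N :=
    continuous_id.matrix_reindex _ _
  refine hre.comp ?_
  have hb : ∀ I J : Fin 2, Continuous fun m : Matrix (Fin 2) (Fin 2) ℂ =>
      blockOf (tLoc q w₀) (nLoc q w₀) (realOf q hw (m I J)).1 (realOf q hw (m I J)).2 := by
    intro I J
    have h1 : Continuous fun m : Matrix (Fin 2) (Fin 2) ℂ => realOf q hw (m I J) :=
      (continuous_realOf q hw).comp (continuous_apply_apply I J)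
    unfold blockOf
    exact ((continuous_fst.comp h1).smul continuous_const).add ((continuous_snd.comp h1).smul continuous_const)
  exact ((hb 0 0).matrix_fromBlocks (hb 0 1) (hb 1 0)) (hb 1 1)

end ModelMore

/-! ## 3. The unitary relation: `ScalarUnitary ↔ locOf m ∈ U(J)`; the equivalence `U(W)(k_{w₀}) ≃ₜ* U(J)` -/

section Unitary

open Summit.Ventures.HodgeRepro.Tier4.Common.SL2Ball

variable {k : Type} [Field k] [NumberField k] (q : QuadData k) (a b ε : k) {w₀ : InfinitePlace k}

/-- The real number `a_{w₀}`. -/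
abbrev alphaLoc (hw : w₀.IsReal) : ℝ :=
  InfinitePlace.Completion.ringEquivRealOfIsReal hw (algebraMap k w₀.Completion a)

/-- The real number `(ε b)_{w₀}`. -/
abbrev betaLoc (hw : w₀.IsReal) : ℝ :=
  InfinitePlace.Completion.ringEquivRealOfIsReal hw (algebraMap k w₀.Completion (ε * b))

omit [NumberField k] in
/-- `Jmat a_{w₀} (ε b)_{w₀}` entrywise, through `ι`. -/
theorem Jmat_apply_iota (hw : w₀.IsReal) (I J : Fin 2) :
    Jmat (alphaLoc a hw) (betaLoc b ε hw) I J =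
      if I = J then (if I = 0 then iota w₀ (algebraMap k w₀.Completion a)
        else iota w₀ (algebraMap k w₀.Completion (ε * b))) else 0 := by
  rw [iota_eq_ofReal hw, iota_eq_ofReal hw]
  fin_cases I <;> fin_cases J <;> simp [Jmat, Matrix.diagonal]

omit [NumberField k] in
/-- The `(I, J)` entry of `m J mᴴ` for `m = locOf M`, as `bw` of the scalar expressions of `ScalarUnitary`. -/
theorem locOf_mul_J_mul_star_apply (hw : w₀.IsReal) (hcm : IsCMAt q w₀) (M : Matrix (Fin 4) (Fin 4) w₀.Completion)
    (I J : Fin 2) :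
    (locOf q w₀ M * Jmat (alphaLoc a hw) (betaLoc b ε hw) * (locOf q w₀ M)ᴴ) I J =
      bw q w₀
        (algebraMap k w₀.Completion a *
            (M (lineBase I) (lineBase 0) * M (lineBase J) (lineBase 0) +
              nLoc q w₀ * M (lineOmega I) (lineBase 0) * M (lineOmega J) (lineBase 0) +
              tLoc q w₀ * M (lineBase I) (lineBase 0) * M (lineOmega J) (lineBase 0)) +
          algebraMap k w₀.Completion (ε * b) *
            (M (lineBase I) (lineBase 1) * M (lineBase J) (lineBase 1) +
              nLoc q w₀ * M (lineOmega I) (lineBase 1) * M (lineOmega J) (lineBase 1) +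
              tLoc q w₀ * M (lineBase I) (lineBase 1) * M (lineOmega J) (lineBase 1)))
        (algebraMap k w₀.Completion a *
            (M (lineOmega I) (lineBase 0) * M (lineBase J) (lineBase 0) -
              M (lineBase I) (lineBase 0) * M (lineOmega J) (lineBase 0)) +
          algebraMap k w₀.Completion (ε * b) *
            (M (lineOmega I) (lineBase 1) * M (lineBase J) (lineBase 1) -
              M (lineBase I) (lineBase 1) * M (lineOmega J) (lineBase 1))) := by
  rw [bw_add, bw_smul, bw_smul, bw_mul_conj q hw hcm, bw_mul_conj q hw hcm]
  simp only [Matrix.mul_apply, Matrix.conjTranspose_apply, Fin.sum_univ_two, Jmat_apply_iota a b ε hw,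
    locOf_apply, Complex.star_def]
  simp only [Fin.isValue, one_ne_zero, zero_ne_one, if_true, if_false, mul_zero, add_zero, zero_add]
  ring

omit [NumberField k] in
/-- `bw d 0 = ι d`. -/
theorem bw_zero_right (d : w₀.Completion) : bw q w₀ d 0 = iota w₀ d := by
  simp only [bw, map_zero, zero_mul, add_zero]

omit [NumberField k] in
/-- **`ScalarUnitary ↔ locOf M ∈ U(J)`** for an `ω`-linear `M` (read each scalar pair through the injective `bw`). -/
theorem scalarUnitary_iff_locOf (hw : w₀.IsReal) (hcm : IsCMAt q w₀) (M : Matrix (Fin 4) (Fin 4) w₀.Completion) :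
    ScalarUnitary q a b ε w₀ (fun I J => M (lineBase I) (lineBase J)) (fun I J => M (lineOmega I) (lineBase J)) ↔
      locOf q w₀ M * Jmat (alphaLoc a hw) (betaLoc b ε hw) * (locOf q w₀ M)ᴴ =
        Jmat (alphaLoc a hw) (betaLoc b ε hw) := by
  unfold ScalarUnitary
  rw [← Matrix.ext_iff]
  refine forall_congr' fun I => forall_congr' fun J => ?_
  beta_reduce
  rw [locOf_mul_J_mul_star_apply q a b ε hw hcm M I J, Jmat_apply_iota a b ε hw]
  have hd : (if I = J then (if I = 0 then iota w₀ (algebraMap k w₀.Completion a)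
      else iota w₀ (algebraMap k w₀.Completion (ε * b))) else 0) =
      bw q w₀ (if I = J then (if I = 0 then algebraMap k w₀.Completion a else algebraMap k w₀.Completion (ε * b))
        else 0) 0 := by
    rw [bw_zero_right]
    split_ifs <;> simp
  rw [hd]
  constructor
  · rintro ⟨hp, hs⟩
    rw [hp, hs]
  · intro h
    exact bw_injective q hw hcm h

omit [NumberField k] in
/-- Every element of `U(W)(k_{w₀})` is `ω`-linear (the first relation of `localUnitary`). -/
theorem isOmegaLinear_of_mem_localUnitary {m : GL (Fin 4) w₀.Completion}
    (hm : m ∈ localUnitary (PlaneData.ofLinesRow q a b ε) w₀) :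
    IsOmegaLinear q w₀ (m : Matrix (Fin 4) (Fin 4) w₀.Completion) := by
  have h := ((mem_localUnitary _ _ _).1 hm).1
  rw [omegaAt_ofLinesRow] at h
  exact h

/-- **`locOf` on `U(W)(k_{w₀})`, as a unit of `M₂(ℂ)`** (inverse `locOf m⁻¹`). -/
def locUnit (hw : w₀.IsReal) (hcm : IsCMAt q w₀) (m : localUnitary (PlaneData.ofLinesRow q a b ε) w₀) :
    GL (Fin 2) ℂ :=
  ⟨locOf q w₀ ((m : GL (Fin 4) w₀.Completion) : Matrix (Fin 4) (Fin 4) w₀.Completion),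
    locOf q w₀ (((m⁻¹ : localUnitary (PlaneData.ofLinesRow q a b ε) w₀) : GL (Fin 4) w₀.Completion) :
      Matrix (Fin 4) (Fin 4) w₀.Completion),
    by
      rw [← locOf_mul q hw hcm (isOmegaLinear_of_mem_localUnitary q a b ε m.2)
        (isOmegaLinear_of_mem_localUnitary q a b ε (m⁻¹).2), ← Units.val_mul, ← Subgroup.coe_mul, mul_inv_cancel,
        Subgroup.coe_one, Units.val_one, locOf_one],
    by
      rw [← locOf_mul q hw hcm (isOmegaLinear_of_mem_localUnitary q a b ε (m⁻¹).2)
        (isOmegaLinear_of_mem_localUnitary q a b ε m.2), ← Units.val_mul, ← Subgroup.coe_mul, inv_mul_cancel,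
        Subgroup.coe_one, Units.val_one, locOf_one]⟩

omit [NumberField k] in
/-- The value of `locUnit`. -/
theorem coe_locUnit (hw : w₀.IsReal) (hcm : IsCMAt q w₀) (m : localUnitary (PlaneData.ofLinesRow q a b ε) w₀) :
    ((locUnit q a b ε hw hcm m : GL (Fin 2) ℂ) : Matrix (Fin 2) (Fin 2) ℂ) =
      locOf q w₀ ((m : GL (Fin 4) w₀.Completion) : Matrix (Fin 4) (Fin 4) w₀.Completion) := rfl

/-- **`locUnit m ∈ U(J)`**: the scalar unitarity equations of `m` read through `bw`. -/
theorem locUnit_mem_UJ (hw : w₀.IsReal) (hcm : IsCMAt q w₀) (hq : 4 * q.n - q.t ^ 2 ≠ 0)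
    (m : localUnitary (PlaneData.ofLinesRow q a b ε) w₀) :
    locUnit q a b ε hw hcm m ∈ UJ (alphaLoc a hw) (betaLoc b ε hw) := by
  rw [mem_UJ, coe_locUnit, ← scalarUnitary_iff_locOf q a b ε hw hcm]
  exact ((mem_localUnitary_ofLinesRow_iff q a b ε w₀ hq _).1 m.2).2

/-- **The homomorphism `U(W)(k_{w₀}) →* U(J)`** given by the complex reading of the blocks. -/
def locHom (hw : w₀.IsReal) (hcm : IsCMAt q w₀) (hq : 4 * q.n - q.t ^ 2 ≠ 0) :
    localUnitary (PlaneData.ofLinesRow q a b ε) w₀ →* UJ (alphaLoc a hw) (betaLoc b ε hw) where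
  toFun m := ⟨locUnit q a b ε hw hcm m, locUnit_mem_UJ q a b ε hw hcm hq m⟩
  map_one' := by
    apply Subtype.ext
    apply Units.ext
    show locOf q w₀ (((1 : localUnitary (PlaneData.ofLinesRow q a b ε) w₀) : GL (Fin 4) w₀.Completion) :
      Matrix (Fin 4) (Fin 4) w₀.Completion) = 1
    rw [Subgroup.coe_one, Units.val_one, locOf_one]
  map_mul' m n := by
    apply Subtype.ext
    apply Units.ext
    show locOf q w₀ (((m * n : localUnitary (PlaneData.ofLinesRow q a b ε) w₀) : GL (Fin 4) w₀.Completion) :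
      Matrix (Fin 4) (Fin 4) w₀.Completion) = _
    rw [Subgroup.coe_mul, Units.val_mul, locOf_mul q hw hcm (isOmegaLinear_of_mem_localUnitary q a b ε m.2)
      (isOmegaLinear_of_mem_localUnitary q a b ε n.2)]
    rfl

/-- The value of `locHom`. -/
theorem coe_locHom (hw : w₀.IsReal) (hcm : IsCMAt q w₀) (hq : 4 * q.n - q.t ^ 2 ≠ 0)
    (m : localUnitary (PlaneData.ofLinesRow q a b ε) w₀) :
    (((locHom q a b ε hw hcm hq m : UJ (alphaLoc a hw) (betaLoc b ε hw)) : GL (Fin 2) ℂ) :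
      Matrix (Fin 2) (Fin 2) ℂ) =
      locOf q w₀ ((m : GL (Fin 4) w₀.Completion) : Matrix (Fin 4) (Fin 4) w₀.Completion) := rfl

/-- **The reassembled unit**: `blocksMat u` for `u ∈ GL₂(ℂ)`, with inverse `blocksMat u⁻¹`. -/
def blocksUnit (hw : w₀.IsReal) (hcm : IsCMAt q w₀) (u : GL (Fin 2) ℂ) : GL (Fin 4) w₀.Completion :=
  ⟨blocksMat q hw (u : Matrix (Fin 2) (Fin 2) ℂ), blocksMat q hw ((u⁻¹ : GL (Fin 2) ℂ) : Matrix (Fin 2) (Fin 2) ℂ),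
    by rw [← blocksMat_mul q hw hcm, Units.mul_inv, blocksMat_one q hw hcm],
    by rw [← blocksMat_mul q hw hcm, Units.inv_mul, blocksMat_one q hw hcm]⟩

omit [NumberField k] in
/-- The value of `blocksUnit`. -/
theorem coe_blocksUnit (hw : w₀.IsReal) (hcm : IsCMAt q w₀) (u : GL (Fin 2) ℂ) :
    ((blocksUnit q hw hcm u : GL (Fin 4) w₀.Completion) : Matrix (Fin 4) (Fin 4) w₀.Completion) =
      blocksMat q hw (u : Matrix (Fin 2) (Fin 2) ℂ) := rfl

/-- **`blocksUnit u ∈ U(W)(k_{w₀})` for `u ∈ U(J)`.** -/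
theorem blocksUnit_mem_localUnitary (hw : w₀.IsReal) (hcm : IsCMAt q w₀) (hq : 4 * q.n - q.t ^ 2 ≠ 0)
    {u : GL (Fin 2) ℂ} (hu : u ∈ UJ (alphaLoc a hw) (betaLoc b ε hw)) :
    blocksUnit q hw hcm u ∈ localUnitary (PlaneData.ofLinesRow q a b ε) w₀ := by
  rw [mem_localUnitary_ofLinesRow_iff q a b ε w₀ hq, coe_blocksUnit]
  refine ⟨fun I J => blocksOfR_blocksMat_eq_blockOf q hw _ I J, ?_⟩
  rw [scalarUnitary_iff_locOf q a b ε hw hcm, locOf_blocksMat q hw hcm]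
  exact (mem_UJ).1 hu

/-- **THE MODEL: `U(W)(k_{w₀}) ≃ₜ* U(J)`** for the row plane at a real CM place, `J = diag (a_{w₀}, (ε b)_{w₀})`. -/
def localModel (hw : w₀.IsReal) (hcm : IsCMAt q w₀) (hq : 4 * q.n - q.t ^ 2 ≠ 0) :
    localUnitary (PlaneData.ofLinesRow q a b ε) w₀ ≃ₜ* UJ (alphaLoc a hw) (betaLoc b ε hw) where
  toFun := locHom q a b ε hw hcm hq
  invFun u := ⟨blocksUnit q hw hcm u, blocksUnit_mem_localUnitary q a b ε hw hcm hq u.2⟩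
  left_inv m := by
    apply Subtype.ext
    apply Units.ext
    rw [coe_blocksUnit, coe_locHom]
    exact blocksMat_locOf q hw hcm (isOmegaLinear_of_mem_localUnitary q a b ε m.2)
  right_inv u := by
    apply Subtype.ext
    apply Units.ext
    rw [coe_locHom, coe_blocksUnit]
    exact locOf_blocksMat q hw hcm _
  map_mul' := (locHom q a b ε hw hcm hq).map_mul
  continuous_toFun := by
    refine Continuous.subtype_mk ?_ _
    refine Units.continuous_iff.2 ⟨?_, ?_⟩
    · show Continuous fun m : localUnitary (PlaneData.ofLinesRow q a b ε) w₀ =>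
        locOf q w₀ ((m : GL (Fin 4) w₀.Completion) : Matrix (Fin 4) (Fin 4) w₀.Completion)
      exact (continuous_locOf q).comp (Units.continuous_val.comp continuous_subtype_val)
    · show Continuous fun m : localUnitary (PlaneData.ofLinesRow q a b ε) w₀ =>
        locOf q w₀ (((m⁻¹ : localUnitary (PlaneData.ofLinesRow q a b ε) w₀) : GL (Fin 4) w₀.Completion) :
          Matrix (Fin 4) (Fin 4) w₀.Completion)
      exact (continuous_locOf q).comp (Units.continuous_val.comp (continuous_subtype_val.comp continuous_inv))
  continuous_invFun := by
    refine Continuous.subtype_mk ?_ _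
    refine Units.continuous_iff.2 ⟨?_, ?_⟩
    · show Continuous fun u : UJ (alphaLoc a hw) (betaLoc b ε hw) =>
        blocksMat q hw ((u : GL (Fin 2) ℂ) : Matrix (Fin 2) (Fin 2) ℂ)
      exact (continuous_blocksMat q hw).comp (Units.continuous_val.comp continuous_subtype_val)
    · show Continuous fun u : UJ (alphaLoc a hw) (betaLoc b ε hw) =>
        blocksMat q hw (((u : GL (Fin 2) ℂ)⁻¹ : GL (Fin 2) ℂ) : Matrix (Fin 2) (Fin 2) ℂ)
      exact (continuous_blocksMat q hw).comp (Units.continuous_coe_inv.comp continuous_subtype_val)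

/-- The value of the model. -/
theorem coe_localModel_apply (hw : w₀.IsReal) (hcm : IsCMAt q w₀) (hq : 4 * q.n - q.t ^ 2 ≠ 0)
    (m : localUnitary (PlaneData.ofLinesRow q a b ε) w₀) :
    (((localModel q a b ε hw hcm hq m : UJ (alphaLoc a hw) (betaLoc b ε hw)) : GL (Fin 2) ℂ) :
      Matrix (Fin 2) (Fin 2) ℂ) =
      locOf q w₀ ((m : GL (Fin 4) w₀.Completion) : Matrix (Fin 4) (Fin 4) w₀.Completion) := rfl

end Unitary

/-! ## 4. The size comparison `ℓ¹ (locOf M) ≤ (1 + ‖ω‖) · ℓ¹ (ι M)` -/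

section Size

variable {k : Type} [Field k] [NumberField k] (q : QuadData k) {w₀ : InfinitePlace k}

omit [NumberField k] in
/-- The eight entries `x_{IJ}`, `y_{IJ}` of the blocks are among the sixteen entries: their `ι`-norms sum to at most
the full `ℓ¹` norm. -/
theorem sum_norm_block_entries_le (M : Matrix (Fin 4) (Fin 4) w₀.Completion) :
    ∑ I : Fin 2, ∑ J : Fin 2, (‖iota w₀ (M (lineBase I) (lineBase J))‖ + ‖iota w₀ (M (lineOmega I) (lineBase J))‖) ≤
      ∑ i : Fin 4, ∑ j : Fin 4, ‖iota w₀ (M i j)‖ := by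
  simp only [Fin.sum_univ_two, Fin.sum_univ_four, lineBase, lineOmega]
  simp only [Fin.isValue, one_ne_zero, if_true, if_false]
  have h := fun i j : Fin 4 => norm_nonneg (iota w₀ (M i j))
  linarith [h 0 1, h 0 3, h 1 1, h 1 3, h 2 1, h 2 3, h 3 1, h 3 3]

omit [NumberField k] in
/-- **THE SIZE COMPARISON**: `l1C (locOf M) ≤ (1 + ‖ω‖) · ∑_{ij} ‖ι (M i j)‖`. -/
theorem l1C_locOf_le (M : Matrix (Fin 4) (Fin 4) w₀.Completion) :
    SL2Ball.l1C (locOf q w₀ M) ≤ (1 + ‖wroot q w₀‖) * ∑ i : Fin 4, ∑ j : Fin 4, ‖iota w₀ (M i j)‖ := by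
  have hω : 0 ≤ 1 + ‖wroot q w₀‖ := by positivity
  calc SL2Ball.l1C (locOf q w₀ M)
      = ∑ I : Fin 2, ∑ J : Fin 2, ‖bw q w₀ (M (lineBase I) (lineBase J)) (M (lineOmega I) (lineBase J))‖ := rfl
    _ ≤ ∑ I : Fin 2, ∑ J : Fin 2,
          (1 + ‖wroot q w₀‖) * (‖iota w₀ (M (lineBase I) (lineBase J))‖ + ‖iota w₀ (M (lineOmega I) (lineBase J))‖) :=
        Finset.sum_le_sum fun I _ => Finset.sum_le_sum fun J _ => norm_bw_le q _ _
    _ = (1 + ‖wroot q w₀‖) * ∑ I : Fin 2, ∑ J : Fin 2,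
          (‖iota w₀ (M (lineBase I) (lineBase J))‖ + ‖iota w₀ (M (lineOmega I) (lineBase J))‖) := by
        simp only [Finset.mul_sum]
    _ ≤ (1 + ‖wroot q w₀‖) * ∑ i : Fin 4, ∑ j : Fin 4, ‖iota w₀ (M i j)‖ :=
        mul_le_mul_of_nonneg_left (sum_norm_block_entries_le M) hω

end Size

end Summit.Ventures.HodgeRepro.Tier4.Line4

end
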